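import Summits.QuantumFields.YangMills.Theorems.BalabanUVNodesN12FlatAveragedCoerciveOfForest
import Summits.QuantumFields.YangMills.Theorems.BalabanUVNodesN12ForestSliceLam
import Summits.QuantumFields.YangMills.Theorems.BalabanUVNodesN07RecordDomainsCollar
import Summits.QuantumFields.YangMills.Theorems.BalabanUVNodesN12TowerSiteGraphConnectedBjPrelim
import Literature.MathematicalPhysics.QuantumFieldTheory.Balaban1983to89.B15Prop1Thm1GeneralFormAtZSequence
import HarnessLib

/-!
# DAG node N12 [B15] — THE FLAT «LEMMA 2.4»-SHAPED COERCIVITY (P♭Q) ON THE **PRINT-ROOTED** FOREST SLICE AT PRINT's DATUM `lamBondsSeq Ω k` ([II] (2.3)) — every (N)(B)(S) sequence and the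
# record's `maxDomT M₁ Z` — PER INSTANCE, from this seat's letter-free (β)♭ `…N12ForestSliceLam` §3 by compactness: the (F)-edition of the lane's `…N12FlatAveragedCoerciveOfForest`
# `c♭·Σ_b‖X_b‖² ≤ d²∕ds² A(e^{sX})|₀ + ‖D(msChartB … (lamBondsSeq Ω k) (M˙1) 1)(0)X‖²` for every field `X` of the print forest slice, some `c♭ > 0`

[Balaban1984PropagatorsII] = «[B6]» ∕ «[II]», (2.3) p. 224, Lemma 2.4 (2.128) p. 245, (2.153) p. 249; [Balaban1989LargeFieldII] = «[LF-II]», p. 357, (1.7)–(1.9) p. 358; [Balaban1985Variational]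
= «[15]», (4) p. 278, (16)–(18) p. 280, (44)–(48) p. 285, (82)–(83) p. 290; [Balaban1988Convergent] = «[III]», (2.2) p. 255, (2.10)–(2.13) pp. 256–257; [Balaban1985RegularSpaces] (1.3)–(1.6)
p. 77, (1.19) p. 79.

Cell `pub-ymgap` (HUMAN RULINGS D-0062 ∕ D-0149), WIDTH SEAT `pub-ymgap-dag-n12-w6` g25 (node N12 = [B15]; key K1⁹ `stmt-QuantumFields-27364`, `--kind proof --supports … --as helper`;
count-neutral).  THEOREMS ONLY (0 `def`, 0 `instance`, 0 `sorry`); the (F) split of record (dag-n12-d g32 ∕ dag-lead WORDS 426∕429; dag-n12-d g32 ■ «(F) `…FlatAveragedCoerciveOfForest` print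
edition → my `…SU2Chart` twin follows by generator»).  BY NAME over landed kernel theorems: the lane's `…N12FlatAveragedCoerciveOfForest.exists_pos_mul_le_of_twoHomogeneous` (compactness of the
unit sphere) and the proof text of its §2 with dag-n12-w3's (β)♭ REPLACED by this seat's g24 `…N12ForestSliceLam.eq_zero_of_fderiv_msChartB_one_eq_zero_of_printForest` (print-rooted forest,
letter-free for (N)(B)(S) sequences — (L♭) = dag-n12-d's `harmonic_lamBondsSeq_nested`); NODE 00's closed form `deriv_deriv_wilsonAction4_expChart_one_eq_norm_sq`.  §1 discharges (S) at the
record's `maxDomT M₁ Z` (`enlT_maxDomT_succ_subset` of `Lit/B15Prop1Thm1GeneralFormAtZSequence` + dag-n07-w3's `mem_enlT_of_distSite_iterBlockOf_le_one`), (N) = r11 `maxDomT_succ_subset`,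
(B) = r11 `isBlockUnion_maxDomT`.  Imports green (no `Record13*`).

WHY.  The (β)-split of the (J0′) producer's Lagrangian-positivity row displays the flat coercivity (P♭Q) on the slice; at print's datum the slice is the PRINT-rooted forest slice (fewer roots
than (b): the inward connectors' deep ends hang in the forest) and the `Q`-term is the derivative of PRINT's chart `msChartB … (lamBondsSeq Ω k) (M˙1) 1`.  Positive-definiteness there is
exactly this seat's (β)♭ at print roots; the domination constant follows by compactness as in the parent (existential per instance — NOT [B6] (2.128)'s `(12d²)⁻¹L^{−d−1}`).

CONTENTS (namespace `Summit.QuantumFields.YangMills.BalabanUVNodes.N12FlatAveragedCoerciveOfForestLam`): §1 ★ `sep_maxDomT` ((S) for the record's maximal sequence, `1 ≤ M₁`), ★★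
`eq_zero_of_fderiv_msChartB_one_eq_zero_of_printForest_maxDomT` ∕ ★★ `hnondeg_real_flat_printForest_maxDomT` (this seat's `…ForestSliceLam` §3 at `Ω := maxDomT M₁ Z`, hypothesis-free but for
`1 ≤ k ≤ m + K`, `1 ≤ M₁`, cover divisibility, (TREE)); §2 ★★★ `exists_flatAveragedCoercive_forest_lamBondsSeq_nested` (every (N)(B)(S) sequence) and ★★★ `exists_flatAveragedCoercive_forest_lamBondsSeq`
(the record; the parent's binders `hk hk1 hM hdiv htree` verbatim with (TREE) on print's roots).  Decl map: `N12FlatAveragedCoerciveOfForest.exists_flatAveragedCoercive_forest_Bj ↦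
N12FlatAveragedCoerciveOfForestLam.exists_flatAveragedCoercive_forest_lamBondsSeq`.

HONEST FRAMING ∕ LOCATED.  Compactness bookkeeping over landed qualitative theorems; the constant `c♭` is EXISTENTIAL per instance (per `(K, k, M₁, Z ∕ Ω, forest)`), NOT print's volume-free one;
nothing of Bałaban's estimates asserted or refuted; count-neutral helper; N12 NOT discharged; K0⁷∕K1⁹ NOT closed; counts unmoved; one finite 𝕋⁴ programme at fixed ε — R4 closes the
conditional finite-𝕋⁴ rung `BalabanLadder.UV` only; NOT continuum ∕ ℝ⁴ ∕ OS; NOT the Yang–Mills mass gap (Clay); no summit statement is proved here.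
-/

noncomputable section

open scoped BigOperators Matrix.Norms.L2Operator Topology

namespace Summit.QuantumFields.YangMills.BalabanUVNodes.N12FlatAveragedCoerciveOfForestLam

open Set Metric Filter
open Literature.MathematicalPhysics.QuantumFieldTheory.Balaban1983to89
open T4Continuum B15DeterminingSets B15DeterminingSetsB GaugeField
open T4AdjointCovarianceUnitary (lieSU)
open Node00 hiding blockIter
open B14.Eq22Determines (blockIter IsBlockUnion)
open B14.Eq213DetSet (maxDomT maxDomT_succ_subset isBlockUnion_maxDomT)
open B14.Eq213MaximalDomains (side)
open B5Eq118OneStroke (iterBlockOf)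
open B5Eq117TorusCarriers (Mk)
open B5Prop12FieldsLattice (distSite distSite_self)
open B5RowSumsP12Lattice (distSite_comm)
open B15Prop1Thm1GeneralFormAtZSequence (enlT_maxDomT_succ_subset)
open Summit.QuantumFields.YangMills.BalabanUVNodes.N07RecordDomainsCollar (mem_enlT_of_distSite_iterBlockOf_le_one)
open Summit.QuantumFields.YangMills.BalabanUVNodes.N12FlatHndRecordLetters (blockIter_eq_iterBlockOf)
open Summit.QuantumFields.YangMills.BalabanUVNodes.N12TowerSiteGraphConnectedBjPrelim (blockIter_shift_or)
open Summit.QuantumFields.YangMills.Theorems.FlatCubeQContraction (distSite_shift_le_one)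
open Summit.QuantumFields.YangMills.BalabanUVNodes.N12FlatAveragedCoerciveOfForest (exists_pos_mul_le_of_twoHomogeneous)
open Summit.QuantumFields.YangMills.BalabanUVNodes.N12ForestSliceLam (eq_zero_of_fderiv_msChartB_one_eq_zero_of_printForest hnondeg_real_flat_printForest)

/-! ## §1  (N)(B)(S) at the record's `maxDomT M₁ Z`; the letter-free (β)♭ there -/

section RecordSeq

variable {P : Params} {k M₁ : ℕ} {Z : Set (Site P 0)}

/-- ★ **(S) FOR `Z`'s MAXIMAL SEQUENCE** (`1 ≤ M₁`, `LᵏM₁ ∣ N₀`): a fine site adjacent to `Ω_{j+1}(Z)` has its whole `(j+1)`-block in `Ω_j(Z)` (`1 ≤ j`, `j + 1 ≤ k`) — one layer of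
`L^{j+1}M₁`-cubes around `Ω_{j+1}` lies in `Ω_j` (`enlT_maxDomT_succ_subset`), and the `(j+1)`-blocks of adjacent sites are within sup-distance `1` (dag-n07-w3's
`mem_enlT_of_distSite_iterBlockOf_le_one`; the same 12 lines as dag-n12-c's `sep_of_seqSeparated`). [cite: Balaban1988Convergent, (2.13) pp.256–257; Balaban1985RegularSpaces, (1.3)–(1.6) p.77] -/
theorem sep_maxDomT (hM : 1 ≤ M₁) (hk : k ≤ P.m + P.K) (hdiv : side P.L M₁ k ∣ P.sitesPerDir 0) :
    ∀ j, 1 ≤ j → j + 1 ≤ k → ∀ (x z : Site P 0) (μ : Fin P.d), (z = x.shift μ ∨ x = z.shift μ) → z ∈ maxDomT M₁ Z (j + 1) →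
      ∀ y : Site P 0, blockIter (j + 1) y = blockIter (j + 1) x → y ∈ maxDomT M₁ Z j := by
  intro j hj1 hjk x z μ hadj hz y hy
  have hjK : j + 1 ≤ P.m + P.K := by omega
  have hd : distSite (Mk P (j + 1)) (iterBlockOf (j + 1) z) (iterBlockOf (j + 1) y) ≤ 1 := by
    rw [← blockIter_eq_iterBlockOf, ← blockIter_eq_iterBlockOf, hy]
    rcases hadj with rfl | rfl
    · rcases blockIter_shift_or hjK x μ with e | e
      · rw [e, distSite_self]; norm_num
      · rw [e, distSite_comm]; exact distSite_shift_le_one _ μ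
    · rcases blockIter_shift_or hjK z μ with e | e
      · rw [e, distSite_self]; norm_num
      · rw [e]; exact distSite_shift_le_one _ μ
  exact enlT_maxDomT_succ_subset hM hdiv hj1 (by omega) (mem_enlT_of_distSite_iterBlockOf_le_one hjK hM hz hd)

variable {F : T4Family} {N : ℕ} [NeZero N] {K : ℕ} {Zr : Set (Site (F.P K) 0)}

/-- ★★ **(β)♭ ON THE PRINT-ROOTED FOREST SLICE AT THE RECORD's `lamBondsSeq (maxDomT M₁ Z) k`, LETTER-FREE** (`1 ≤ k ≤ m + K`, `1 ≤ M₁`, cover divisibility): a field in the print forest slice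
killed by `D(msChartB … (lamBondsSeq (maxDomT M₁ Z) k) (M˙1) 1)(0)` with vanishing flat second variation is `0` — this seat's `…ForestSliceLam` §3 at `Ω := maxDomT M₁ Z` with (N) r11
`maxDomT_succ_subset`, (B) r11 `isBlockUnion_maxDomT`, (S) `sep_maxDomT`. [cite: Balaban1984PropagatorsII, (2.3) p.224; Balaban1989LargeFieldII, (1.9) p.358, p.359; Balaban1985Variational, (4) p.278, (16)–(18) p.280; Balaban1988Convergent, (2.2) p.255, (2.13) pp.256–257] -/
theorem eq_zero_of_fderiv_msChartB_one_eq_zero_of_printForest_maxDomT {M₁ : ℕ} (hk1 : 1 ≤ k) (hk : k ≤ (F.P K).m + (F.P K).K) (hM : 1 ≤ M₁)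
    (hdiv : side (F.P K).L M₁ k ∣ (F.P K).sitesPerDir 0)
    {path : Site (F.P K) 0 → List (LStep (F.P K) 0)}
    (htree : ∀ x : Site (F.P K) 0, x ∉ {z : Site (F.P K) 0 | ∃ j, j ≤ k ∧ ∃ c ∈ lamBondsSeq (maxDomT M₁ Zr) k j, (z = embIter j c.src ∨ z = embIter j c.tgt)} →
      ∃ (x' : Site (F.P K) 0) (s : LStep (F.P K) 0), path x = path x' ++ [s] ∧
        (s.fwd = true → s.bond.src = x' ∧ s.bond.tgt = x) ∧ (s.fwd = false → s.bond.src = x ∧ s.bond.tgt = x'))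
    {X : PBond (F.P K) 0 → lieSU (Fin N)} (hax : ∀ x, ∀ s ∈ path x, X s.bond = 0)
    (hker : fderiv ℝ (msChartB F N K k (lamBondsSeq (maxDomT M₁ Zr) k) (avgFamily (avOfRecord F N K) (1 : GaugeField (F.P K) 0 (SU N))) (1 : GaugeField (F.P K) 0 (SU N))) 0 X = 0)
    (hflat : deriv (deriv fun s : ℝ => wilsonAction4 (expChart (1 : GaugeField (F.P K) 0 (SU N)) (s • X))) 0 = 0) :
    X = 0 :=
  eq_zero_of_fderiv_msChartB_one_eq_zero_of_printForest hk1 hk (fun j _ _ => maxDomT_succ_subset hM Zr j)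
    (fun _ hj1 hjk => isBlockUnion_maxDomT hM hdiv hj1 hjk (hjk.trans hk)) (sep_maxDomT hM hk hdiv) htree hax hker hflat

/-- ★★ **THE FLAT REAL `hnondeg` LETTER ON THE PRINT FOREST SLICE AT THE RECORD, LETTER-FREE** (dag-n12-w1's (β) shape; `Ω := maxDomT M₁ Z`).
[cite: Balaban1984PropagatorsII, (2.3) p.224; Balaban1989LargeFieldII, (1.9) p.358, p.359; Balaban1985Variational, (4) p.278, (16)–(18) p.280; Balaban1988Convergent, (2.13) pp.256–257] -/
theorem hnondeg_real_flat_printForest_maxDomT {M₁ : ℕ} (hk1 : 1 ≤ k) (hk : k ≤ (F.P K).m + (F.P K).K) (hM : 1 ≤ M₁)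
    (hdiv : side (F.P K).L M₁ k ∣ (F.P K).sitesPerDir 0)
    {path : Site (F.P K) 0 → List (LStep (F.P K) 0)}
    (htree : ∀ x : Site (F.P K) 0, x ∉ {z : Site (F.P K) 0 | ∃ j, j ≤ k ∧ ∃ c ∈ lamBondsSeq (maxDomT M₁ Zr) k j, (z = embIter j c.src ∨ z = embIter j c.tgt)} →
      ∃ (x' : Site (F.P K) 0) (s : LStep (F.P K) 0), path x = path x' ++ [s] ∧
        (s.fwd = true → s.bond.src = x' ∧ s.bond.tgt = x) ∧ (s.fwd = false → s.bond.src = x ∧ s.bond.tgt = x'))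
    (s : PBond (F.P K) 0 → lieSU (Fin N)) (hs : ∀ x, ∀ u ∈ path x, s u.bond = 0)
    (hker : fderiv ℝ (msChartB F N K k (lamBondsSeq (maxDomT M₁ Zr) k) (avgFamily (avOfRecord F N K) (1 : GaugeField (F.P K) 0 (SU N))) (1 : GaugeField (F.P K) 0 (SU N))) 0 s = 0)
    (hq : ∀ t : PBond (F.P K) 0 → lieSU (Fin N), (∀ x, ∀ u ∈ path x, t u.bond = 0) →
      fderiv ℝ (msChartB F N K k (lamBondsSeq (maxDomT M₁ Zr) k) (avgFamily (avOfRecord F N K) (1 : GaugeField (F.P K) 0 (SU N))) (1 : GaugeField (F.P K) 0 (SU N))) 0 t = 0 →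
      fderiv ℝ (fun Y => fderiv ℝ (fun Y : PBond (F.P K) 0 → lieSU (Fin N) => wilsonAction4 (expChart (1 : GaugeField (F.P K) 0 (SU N)) Y)) Y) 0 s t = 0) :
    s = 0 :=
  hnondeg_real_flat_printForest hk1 hk (fun j _ _ => maxDomT_succ_subset hM Zr j)
    (fun _ hj1 hjk => isBlockUnion_maxDomT hM hdiv hj1 hjk (hjk.trans hk)) (sep_maxDomT hM hk hdiv) htree s hs hker hq

end RecordSeq

/-! ## §2  (P♭Q) on the print-rooted forest slice at PRINT's datum, per instance -/

section Coercive

variable {F : T4Family} {N : ℕ} [NeZero N] {K k : ℕ}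

/-- ★★★ **THE FLAT «LEMMA 2.4»-SHAPED COERCIVITY ON THE PRINT-ROOTED FOREST SLICE, EVERY (N)(B)(S) SEQUENCE, PER INSTANCE.**  At `U = 1` with its own flat datum `M˙(1)` and print's datum
`lamBondsSeq Ω k` over a nested (N), block-aligned (B), separated (S) sequence `Ω` (`1 ≤ k ≤ m + K`), for a forest `path` in which every site off print's tower sites hangs ((TREE)): there is
`c♭ > 0` with `c♭·Σ_b‖X_b‖² ≤ d²∕ds² A(e^{sX})|₀ + ‖D(msChartB … (lamBondsSeq Ω k) (M˙1) 1)(0) X‖²` for EVERY `𝔰𝔲(N)`-field `X` vanishing on the forest's path bonds.  Proof: the parent's §2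
text with positive-definiteness from this seat's `eq_zero_of_fderiv_msChartB_one_eq_zero_of_printForest`.
[cite: Balaban1984PropagatorsII, (2.3) p.224, Lemma 2.4 (2.128) p.245, (2.153) p.249; Balaban1989LargeFieldII, p.357, (1.9) p.358; Balaban1985Variational, (4) p.278, (44)–(48) p.285, (82)–(83) p.290; Balaban1988Convergent, (2.2) p.255, (2.10)–(2.13) pp.256–257] -/
theorem exists_flatAveragedCoercive_forest_lamBondsSeq_nested {Ω : ℕ → Set (Site (F.P K) 0)} (hk1 : 1 ≤ k) (hk : k ≤ (F.P K).m + (F.P K).K)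
    (hnest : ∀ j, 1 ≤ j → j < k → Ω (j + 1) ⊆ Ω j) (hBU : ∀ j, 1 ≤ j → j ≤ k → IsBlockUnion j (Ω j))
    (hsep : ∀ j, 1 ≤ j → j + 1 ≤ k → ∀ (x z : Site (F.P K) 0) (μ : Fin (F.P K).d), (z = x.shift μ ∨ x = z.shift μ) → z ∈ Ω (j + 1) →
      ∀ y : Site (F.P K) 0, blockIter (j + 1) y = blockIter (j + 1) x → y ∈ Ω j)
    {path : Site (F.P K) 0 → List (LStep (F.P K) 0)}
    (htree : ∀ x : Site (F.P K) 0, x ∉ {z : Site (F.P K) 0 | ∃ j, j ≤ k ∧ ∃ c ∈ lamBondsSeq Ω k j, (z = embIter j c.src ∨ z = embIter j c.tgt)} →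
      ∃ (x' : Site (F.P K) 0) (s : LStep (F.P K) 0), path x = path x' ++ [s] ∧
        (s.fwd = true → s.bond.src = x' ∧ s.bond.tgt = x) ∧ (s.fwd = false → s.bond.src = x ∧ s.bond.tgt = x')) :
    ∃ cflat : ℝ, 0 < cflat ∧ ∀ X : PBond (F.P K) 0 → lieSU (Fin N), (∀ x, ∀ s ∈ path x, X s.bond = 0) →
      cflat * ∑ b : PBond (F.P K) 0, ‖X b‖ ^ 2 ≤
        deriv (deriv fun s : ℝ => wilsonAction4 (expChart (1 : GaugeField (F.P K) 0 (SU N)) (s • X))) 0 +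
          ‖fderiv ℝ (msChartB F N K k (lamBondsSeq Ω k) (avgFamily (avOfRecord F N K) (1 : GaugeField (F.P K) 0 (SU N))) (1 : GaugeField (F.P K) 0 (SU N))) 0 X‖ ^ 2 := by
  -- the forest slice as a finite-dimensional real subspace
  let Sl : Submodule ℝ (PBond (F.P K) 0 → lieSU (Fin N)) :=
    { carrier := {X | ∀ x, ∀ s ∈ path x, X s.bond = 0}
      add_mem' := fun {X Y} hX hY x s hs => by
        show X s.bond + Y s.bond = 0
        rw [hX x s hs, hY x s hs, add_zero]
      zero_mem' := fun _ _ _ => rfl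
      smul_mem' := fun t X hX x s hs => by
        show t • X s.bond = 0
        rw [hX x s hs, smul_zero] }
  set L := fderiv ℝ (msChartB F N K k (lamBondsSeq Ω k) (avgFamily (avOfRecord F N K) (1 : GaugeField (F.P K) 0 (SU N))) (1 : GaugeField (F.P K) 0 (SU N))) 0 with hL
  -- the two quadratic forms, read on the ambient space
  let curlSq : (PBond (F.P K) 0 → lieSU (Fin N)) → ℝ := fun X =>
    ∑ p : Plaq (F.P K) 0, ‖X ⟨p.src, p.μ⟩ + X ⟨p.src.shift p.μ, p.ν⟩ - X ⟨p.src.shift p.ν, p.μ⟩ - X ⟨p.src, p.ν⟩‖ ^ 2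
  let fA : (PBond (F.P K) 0 → lieSU (Fin N)) → ℝ := fun X => curlSq X / (Fintype.card (Fin N) : ℝ) + ‖L X‖ ^ 2
  let gA : (PBond (F.P K) 0 → lieSU (Fin N)) → ℝ := fun X => ∑ b : PBond (F.P K) 0, ‖X b‖ ^ 2
  have hev : ∀ b : PBond (F.P K) 0, Continuous fun X : PBond (F.P K) 0 → lieSU (Fin N) => X b := fun b => continuous_apply b
  have hcurl_cont : Continuous curlSq := by
    refine continuous_finsetSum _ fun p _ => ?_
    exact ((((hev _).add (hev _)).sub (hev _)).sub (hev _)).norm.pow 2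
  have hfA_cont : Continuous fA := (hcurl_cont.div_const _).add (L.continuous.norm.pow 2)
  have hgA_cont : Continuous gA := continuous_finsetSum _ fun b _ => (hev b).norm.pow 2
  have hcurl2 : ∀ (t : ℝ) (X : PBond (F.P K) 0 → lieSU (Fin N)), curlSq (t • X) = t ^ 2 * curlSq X := by
    intro t X
    simp only [curlSq, Pi.smul_apply, ← smul_add, ← smul_sub, norm_smul, Real.norm_eq_abs, mul_pow, sq_abs, Finset.mul_sum]
  have hfA2 : ∀ (t : ℝ) (X : PBond (F.P K) 0 → lieSU (Fin N)), fA (t • X) = t ^ 2 * fA X := by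
    intro t X
    simp only [fA]
    rw [hcurl2, map_smul, norm_smul, Real.norm_eq_abs, mul_pow, sq_abs, mul_add, mul_div_assoc]
  have hgA2 : ∀ (t : ℝ) (X : PBond (F.P K) 0 → lieSU (Fin N)), gA (t • X) = t ^ 2 * gA X := by
    intro t X
    simp only [gA, Pi.smul_apply, norm_smul, Real.norm_eq_abs, mul_pow, sq_abs, Finset.mul_sum]
  -- the closed form of the flat second variation
  have hflat : ∀ X : PBond (F.P K) 0 → lieSU (Fin N),
      deriv (deriv fun s : ℝ => wilsonAction4 (expChart (1 : GaugeField (F.P K) 0 (SU N)) (s • X))) 0 = curlSq X / (Fintype.card (Fin N) : ℝ) :=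
    fun X => deriv_deriv_wilsonAction4_expChart_one_eq_norm_sq X
  -- restrict to the slice
  have hf_cont : Continuous fun X : Sl => fA (X : PBond (F.P K) 0 → lieSU (Fin N)) := hfA_cont.comp continuous_subtype_val
  have hg_cont : Continuous fun X : Sl => gA (X : PBond (F.P K) 0 → lieSU (Fin N)) := hgA_cont.comp continuous_subtype_val
  have hf2 : ∀ (t : ℝ) (X : Sl), fA ((t • X : Sl) : PBond (F.P K) 0 → lieSU (Fin N)) = t ^ 2 * fA (X : PBond (F.P K) 0 → lieSU (Fin N)) :=
    fun t X => by rw [Submodule.coe_smul, hfA2]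
  have hg2 : ∀ (t : ℝ) (X : Sl), gA ((t • X : Sl) : PBond (F.P K) 0 → lieSU (Fin N)) = t ^ 2 * gA (X : PBond (F.P K) 0 → lieSU (Fin N)) :=
    fun t X => by rw [Submodule.coe_smul, hgA2]
  -- positivity on the slice: this seat's (β)♭ at print roots
  have hposSl : ∀ X : Sl, X ≠ 0 → 0 < fA (X : PBond (F.P K) 0 → lieSU (Fin N)) := by
    intro X hX
    have hN : (0 : ℝ) < (Fintype.card (Fin N) : ℝ) := by
      have : 0 < Fintype.card (Fin N) := by rw [Fintype.card_fin]; exact Nat.pos_of_ne_zero (NeZero.ne N)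
      exact_mod_cast this
    have hcurl0 : 0 ≤ curlSq (X : PBond (F.P K) 0 → lieSU (Fin N)) := Finset.sum_nonneg fun _ _ => by positivity
    have h1 : 0 ≤ curlSq (X : PBond (F.P K) 0 → lieSU (Fin N)) / (Fintype.card (Fin N) : ℝ) := div_nonneg hcurl0 hN.le
    have h2 : 0 ≤ ‖L (X : PBond (F.P K) 0 → lieSU (Fin N))‖ ^ 2 := by positivity
    by_contra hle
    push Not at hle
    have hsum0 : curlSq (X : PBond (F.P K) 0 → lieSU (Fin N)) / (Fintype.card (Fin N) : ℝ) = 0 ∧ ‖L (X : PBond (F.P K) 0 → lieSU (Fin N))‖ ^ 2 = 0 := by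
      constructor <;> linarith
    have hflat0 : deriv (deriv fun s : ℝ => wilsonAction4 (expChart (1 : GaugeField (F.P K) 0 (SU N)) (s • (X : PBond (F.P K) 0 → lieSU (Fin N))))) 0 = 0 := by
      rw [hflat, hsum0.1]
    have hker : L (X : PBond (F.P K) 0 → lieSU (Fin N)) = 0 := by
      have := hsum0.2
      rwa [sq_eq_zero_iff, norm_eq_zero] at this
    have hX0 : (X : PBond (F.P K) 0 → lieSU (Fin N)) = 0 :=
      eq_zero_of_fderiv_msChartB_one_eq_zero_of_printForest hk1 hk hnest hBU hsep htree X.2 hker hflat0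
    exact hX (Subtype.ext hX0)
  -- the parent's §1 on the slice
  obtain ⟨c, hc, hcle⟩ := exists_pos_mul_le_of_twoHomogeneous (E := Sl) hf_cont hg_cont hf2 hg2 hposSl
  refine ⟨c, hc, fun X hX => ?_⟩
  have h := hcle ⟨X, hX⟩
  rw [hflat X]
  exact h

/-- ★★★ **THE FLAT «LEMMA 2.4»-SHAPED COERCIVITY ON THE PRINT-ROOTED FOREST SLICE AT THE RECORD, PER INSTANCE** — the parent's `exists_flatAveragedCoercive_forest_Bj` binder-for-binder
(`k ≤ m + K`, `1 ≤ k`, `1 ≤ M₁`, the cover divisibility, (TREE) — now on PRINT's roots) with the `Q`-term over print's chart `msChartB … (lamBondsSeq (maxDomT M₁ Z) k) (M˙1) 1` and the slice of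
the PRINT-rooted forest (this seat's `…RootedForestLamOfRecord.exists_rootedForest_lamBondsSeq_maxDomT` supplies one).
[cite: Balaban1984PropagatorsII, (2.3) p.224, Lemma 2.4 (2.128) p.245, (2.153) p.249; Balaban1989LargeFieldII, p.357, (1.9) p.358; Balaban1985Variational, (4) p.278, (44)–(48) p.285, (82)–(83) p.290; Balaban1988Convergent, (2.2) p.255, (2.10)–(2.13) pp.256–257; Balaban1985BackgroundPropagators, (3.10) p.392] -/
theorem exists_flatAveragedCoercive_forest_lamBondsSeq {M₁ : ℕ} {Z : Set (Site (F.P K) 0)} (hk : k ≤ (F.P K).m + (F.P K).K) (hk1 : 1 ≤ k) (hM : 1 ≤ M₁)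
    (hdiv : side (F.P K).L M₁ k ∣ (F.P K).sitesPerDir 0)
    {path : Site (F.P K) 0 → List (LStep (F.P K) 0)}
    (htree : ∀ x : Site (F.P K) 0, x ∉ {z : Site (F.P K) 0 | ∃ j, j ≤ k ∧ ∃ c ∈ lamBondsSeq (maxDomT M₁ Z) k j, (z = embIter j c.src ∨ z = embIter j c.tgt)} →
      ∃ (x' : Site (F.P K) 0) (s : LStep (F.P K) 0), path x = path x' ++ [s] ∧
        (s.fwd = true → s.bond.src = x' ∧ s.bond.tgt = x) ∧ (s.fwd = false → s.bond.src = x ∧ s.bond.tgt = x')) :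
    ∃ cflat : ℝ, 0 < cflat ∧ ∀ X : PBond (F.P K) 0 → lieSU (Fin N), (∀ x, ∀ s ∈ path x, X s.bond = 0) →
      cflat * ∑ b : PBond (F.P K) 0, ‖X b‖ ^ 2 ≤
        deriv (deriv fun s : ℝ => wilsonAction4 (expChart (1 : GaugeField (F.P K) 0 (SU N)) (s • X))) 0 +
          ‖fderiv ℝ (msChartB F N K k (lamBondsSeq (maxDomT M₁ Z) k) (avgFamily (avOfRecord F N K) (1 : GaugeField (F.P K) 0 (SU N))) (1 : GaugeField (F.P K) 0 (SU N))) 0 X‖ ^ 2 :=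
  exists_flatAveragedCoercive_forest_lamBondsSeq_nested hk1 hk (fun j _ _ => maxDomT_succ_subset hM Z j)
    (fun _ hj1 hjk => isBlockUnion_maxDomT hM hdiv hj1 hjk (hjk.trans hk)) (sep_maxDomT hM hk hdiv) htree

end Coercive

end Summit.QuantumFields.YangMills.BalabanUVNodes.N12FlatAveragedCoerciveOfForestLam

end
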